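import Summits.PneNP.PneNP.Theorems.ConvexRankGatesConvexGateBlindExactLiftingTriangleRegrouping
import Summits.PneNP.PneNP.Theorems.ConvexRankGatesConvexGateBlindExactLiftingTriangleJumpGen

/-!
# Triangle instance — regrouping rigidity from the combinatorial covering statement (COV-rigidity)

Support file for crux `ConvexGateBlind` (stmt-PneNP-10680), open stub `stub_exactLifting`; prover seat 0, session 35,
memo ANALYSIS14 §5. The REDUCTION of "the lines are the only `≤ 3t²`-term non-negative factorisation of `M_t` with generators in
`cone{1_L}`" (regrouping rigidity = R1′ in the regrouping class) to a purely combinatorial statement about edge sets of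
`K_{t,t,t}`:

**COV-rigidity(t)** (hypothesis `hcov`, stated inline; proved on paper for `t ≥ 5` in the memo, §5.4–5.6, by an explicit LP dual
— one biased probability measure per edge — and an equality analysis; exhaustive exact checks at `t = 4`; NOT yet in Lean): if a
family of nonempty sets of lines `E i` (`i : ι`) COVERS — for every nondegenerate row `x` (`mu x ≠ 0`) and every line `L`
monochromatic under `x` some `E i ∋ L` consists of monochromatic lines only — then `#ι ≥ 3t²`, and if `#ι = 3t²` every `E i` is
a singleton.

**Theorem (`regroupingRigid_of_cov`).** Assume COV-rigidity(t), `t ≥ 2`. If `M_t = Σ_i u_i ⊗ g_i` with `u ≥ 0`,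
`g_i = Σ_L α_{iL} 1_L`, `α ≥ 0`, and `#ι ≤ 3t²`, then `#ι = 3t²` and there is a bijection `σ : ι ≃ Line t` with
`α_{iL} > 0 ⟺ L = σ i`: every generator is a positive multiple of its own line, each line once (`regroupingRigid_terms`: the
terms are `c_i(x)·1_{σ i}(w)` — the conclusion of R1′ for this factorisation). Proof: by `regrouping_coeff` / `regrouping_usage`
(file `…TriangleRegrouping`) the supports `E i := {L : α_{iL} > 0}` satisfy the covering hypothesis; COV-rigidity makes them
singletons; every line is monochromatic under some nondegenerate row (`goodRow`), so `i ↦ L_i` is onto, hence bijective.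
Registered sub-goal `triangle_regrouping_rigidity_of_cov` (self-contained signature).
-/

set_option linter.dupNamespace false -- `Summit.PneNP.PneNP.…`: summit = sub-problem (D-0017)

namespace Summit.PneNP.PneNP.Theorems.XorDoor.TriLine

open Finset

noncomputable section

variable {t : ℕ} {ι : Type} [Fintype ι]

/-- the good row makes its line monochromatic -/
lemma lmono_goodRow (p₀ : Fin t) (L : Line t) : lmono (goodRow p₀ L) L := by
  have h := mInd_goodRow p₀ L
  by_contra hm
  unfold mInd at h
  rw [if_neg hm] at h
  exact zero_ne_one h

/-- **Regrouping rigidity from COV-rigidity.** See the module docstring. -/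
theorem regroupingRigid_of_cov (ht : 2 ≤ t)
    (hcov : ∀ E : ι → Finset (Line t), (∀ i, (E i).Nonempty) →
      (∀ x : Col t, mu x ≠ 0 → ∀ L, lmono x L → ∃ i, L ∈ E i ∧ ∀ L' ∈ E i, lmono x L') →
      3 * t ^ 2 ≤ Fintype.card ι ∧ (Fintype.card ι = 3 * t ^ 2 → ∀ i, (E i).card = 1))
    (hι : Fintype.card ι ≤ 3 * t ^ 2) {u : ι → Col t → ℝ} (hu : ∀ i x, 0 ≤ u i x) {α : ι → Line t → ℝ}
    (hα : ∀ i L, 0 ≤ α i L) (hfact : ∀ x w, ∑ i, u i x * ∑ L, α i L * lind L w = (monoCount x w : ℝ)) :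
    Fintype.card ι = 3 * t ^ 2 ∧ ∃ σ : ι ≃ Line t, ∀ i L, 0 < α i L ↔ L = σ i := by
  classical
  haveI : Nonempty (Line t) := ⟨Sum.inl (⟨0, by omega⟩, ⟨0, by omega⟩)⟩
  -- supports of the generators, padded to be nonempty
  set E : ι → Finset (Line t) := fun i => univ.filter fun L => 0 < α i L with hE
  set E' : ι → Finset (Line t) := fun i => if (E i).Nonempty then E i else univ with hE'
  have hE'ne : ∀ i, (E' i).Nonempty := by
    intro i; simp only [hE']; split_ifs with h; exact h; exact univ_nonempty
  -- the covering property (COV)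
  have hcovE : ∀ x : Col t, mu x ≠ 0 → ∀ L, lmono x L → ∃ i, L ∈ E' i ∧ ∀ L' ∈ E' i, lmono x L' := by
    intro x hx L hL
    have hsum := regrouping_coeff hx (fun i => hu i x) hα (hfact x) L
    unfold mInd at hsum
    rw [if_pos hL] at hsum
    obtain ⟨i, -, hi⟩ : ∃ i ∈ (univ : Finset ι), 0 < u i x * α i L := by
      by_contra hno
      push Not at hno
      have : ∑ i, u i x * α i L ≤ 0 := sum_nonpos fun i hi => hno i hi
      linarith
    have hui : 0 < u i x := by
      rcases (hu i x).lt_or_eq with h | h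
      · exact h
      · rw [← h, zero_mul] at hi; exact (lt_irrefl _ hi).elim
    have hαi : 0 < α i L := by
      rcases (hα i L).lt_or_eq with h | h
      · exact h
      · rw [← h, mul_zero] at hi; exact (lt_irrefl _ hi).elim
    have hLE : L ∈ E i := by simp [hE, hαi]
    have hne : (E i).Nonempty := ⟨L, hLE⟩
    have hEq : E' i = E i := by simp only [hE']; rw [if_pos hne]
    refine ⟨i, by rw [hEq]; exact hLE, fun L' hL' => ?_⟩
    rw [hEq] at hL'
    have hαL' : 0 < α i L' := by simpa [hE] using hL'
    exact regrouping_usage hx (fun i => hu i x) hα (hfact x) hui hαL'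
  obtain ⟨hge, hone⟩ := hcov E' hE'ne hcovE
  have hcard : Fintype.card ι = 3 * t ^ 2 := le_antisymm hι hge
  have hone' := hone hcard
  have hcardL : Fintype.card (Line t) = 3 * t ^ 2 := by
    simp only [Line, Fintype.card_sum, Fintype.card_prod, Fintype.card_fin]; ring
  -- no padding happened: every support is a singleton
  have hEne : ∀ i, (E i).Nonempty := by
    intro i
    by_contra h
    have h1 := hone' i
    simp only [hE'] at h1
    rw [if_neg h, card_univ, hcardL] at h1
    nlinarith
  have hsingle : ∀ i, ∃ L, E i = {L} := by
    intro i
    have h1 := hone' i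
    simp only [hE'] at h1
    rw [if_pos (hEne i)] at h1
    exact card_eq_one.1 h1
  choose f hf using hsingle
  have hmem : ∀ i L, 0 < α i L ↔ L = f i := by
    intro i L
    have : L ∈ E i ↔ L ∈ ({f i} : Finset (Line t)) := by rw [hf i]
    simpa [hE] using this
  -- `f` is onto (every line is monochromatic under some nondegenerate row), hence a bijection
  obtain ⟨p₀⟩ : Nonempty (Fin t) := ⟨⟨0, by omega⟩⟩
  have hsurj : Function.Surjective f := by
    intro L
    obtain ⟨i, hiL, -⟩ := hcovE (goodRow p₀ L) (mu_goodRow_ne_zero ht p₀ L) L (lmono_goodRow p₀ L)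
    have hEq : E' i = E i := by simp only [hE']; rw [if_pos (hEne i)]
    rw [hEq, hf i, mem_singleton] at hiL
    exact ⟨i, hiL.symm⟩
  have hbij : Function.Bijective f := by
    rw [Fintype.bijective_iff_surjective_and_card]
    exact ⟨hsurj, by rw [hcard, hcardL]⟩
  exact ⟨hcard, Equiv.ofBijective f hbij, fun i L => by rw [hmem i L]; rfl⟩

omit [Fintype ι] in
/-- **The terms of a rigid regrouping** are `c_i(x)·1_{σ i}(w)`: the R1′ conclusion for this factorisation. -/
theorem regroupingRigid_terms {u : ι → Col t → ℝ} {α : ι → Line t → ℝ} (hα : ∀ i L, 0 ≤ α i L) (σ : ι ≃ Line t)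
    (hσ : ∀ i L, 0 < α i L ↔ L = σ i) :
    ∀ i x w, u i x * ∑ L, α i L * lind L w = (u i x * α i (σ i)) * lind (σ i) w := by
  classical
  intro i x w
  rw [Fintype.sum_eq_single (σ i)]
  · ring
  · intro L hL
    have : α i L = 0 := by
      rcases (hα i L).lt_or_eq with h | h
      · exact absurd ((hσ i L).1 h) hL
      · exact h.symm
    rw [this, zero_mul]

/-- **Regrouping rigidity of the cheap corner of the triangle matrix, from COV-rigidity** (registered sub-goal
`triangle_regrouping_rigidity_of_cov` of stmt-PneNP-10680, verbatim signature, self-contained vocabulary). Rows `x` = three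
`2`-colourings of `Fin t`; lines `(Fin t × Fin t) ⊕ (Fin t × Fin t) ⊕ (Fin t × Fin t)`; "`L` monochromatic under `x`" and
"`w ∈ L`" written out with `Sum.elim`; nondegenerate = every block two-coloured. HYPOTHESIS: COV-rigidity(t) for families indexed by
`Fin R`. CONCLUSION (`t ≥ 2`): a non-negative factorisation of `M_t` with `R ≤ 3t²` terms whose column functions are non-negative
combinations of line indicators has `R = 3t²` and every generator supported on exactly one line, all lines distinct. -/
theorem triangle_regrouping_rigidity_of_cov : ∀ (t R : ℕ), 2 ≤ t → (∀ E : Fin R → Finset ((Fin t × Fin t) ⊕ (Fin t × Fin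
    t) ⊕ (Fin t × Fin t)), (∀ i, (E i).Nonempty) → (∀ x : (Fin t → Bool) × (Fin t → Bool) × (Fin t → Bool), ((∃ a a', x.1 a
    ≠ x.1 a') ∧ (∃ b b', x.2.1 b ≠ x.2.1 b') ∧ (∃ d d', x.2.2 d ≠ x.2.2 d')) → ∀ L, Sum.elim (fun ab : Fin t × Fin t =>
    x.1 ab.1 = x.2.1 ab.2) (Sum.elim (fun ad : Fin t × Fin t => x.1 ad.1 = x.2.2 ad.2) (fun bd : Fin t × Fin t => x.2.1
    bd.1 = x.2.2 bd.2)) L → ∃ i, L ∈ E i ∧ ∀ L' ∈ E i, Sum.elim (fun ab : Fin t × Fin t => x.1 ab.1 = x.2.1 ab.2)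
    (Sum.elim (fun ad : Fin t × Fin t => x.1 ad.1 = x.2.2 ad.2) (fun bd : Fin t × Fin t => x.2.1 bd.1 = x.2.2 bd.2))
    L') → 3 * t ^ 2 ≤ R ∧ (R = 3 * t ^ 2 → ∀ i, (E i).card = 1)) → ∀ (u : Fin R → (Fin t → Bool) × (Fin t → Bool) ×
    (Fin t → Bool) → ℝ) (α : Fin R → (Fin t × Fin t) ⊕ (Fin t × Fin t) ⊕ (Fin t × Fin t) → ℝ), R ≤ 3 * t ^ 2 → (∀ i
    x, 0 ≤ u i x) → (∀ i L, 0 ≤ α i L) → (∀ (x : (Fin t → Bool) × (Fin t → Bool) × (Fin t → Bool)) (w : Fin t × Fin t ×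
    Fin t), ∑ i, u i x * ∑ L, α i L * Sum.elim (fun ab : Fin t × Fin t => if w.1 = ab.1 ∧ w.2.1 = ab.2 then (1 : ℝ)
    else 0) (Sum.elim (fun ad : Fin t × Fin t => if w.1 = ad.1 ∧ w.2.2 = ad.2 then (1 : ℝ) else 0) (fun bd : Fin t ×
    Fin t => if w.2.1 = bd.1 ∧ w.2.2 = bd.2 then (1 : ℝ) else 0)) L = ((if x.1 w.1 = x.2.1 w.2.1 then 1 else 0) + (if
    x.1 w.1 = x.2.2 w.2.2 then 1 else 0) + (if x.2.1 w.2.1 = x.2.2 w.2.2 then 1 else 0) : ℝ)) → R = 3 * t ^ 2 ∧ ∃ σ :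
    Fin R ≃ ((Fin t × Fin t) ⊕ (Fin t × Fin t) ⊕ (Fin t × Fin t)), ∀ i L, 0 < α i L ↔ L = σ i := by
  intro t R ht hcov u α hR hu hα hfact
  have hcov' : ∀ E : Fin R → Finset (Line t), (∀ i, (E i).Nonempty) →
      (∀ x : Col t, mu x ≠ 0 → ∀ L, lmono x L → ∃ i, L ∈ E i ∧ ∀ L' ∈ E i, lmono x L') →
      3 * t ^ 2 ≤ Fintype.card (Fin R) ∧ (Fintype.card (Fin R) = 3 * t ^ 2 → ∀ i, (E i).card = 1) := by
    intro E hne hc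
    rw [Fintype.card_fin]
    exact hcov E hne fun x hx L hL => hc x ((mu_ne_zero_iff_two_coloured x).2 hx) L hL
  have hf : ∀ x w, ∑ i, u i x * ∑ L, α i L * lind L w = (monoCount x w : ℝ) := by
    intro x w
    rw [← sum_congr rfl fun i _ => by rw [← sum_congr rfl fun L _ => by rw [lind_eq_elim L w]], hfact x w]
    simp only [monoCount]; push_cast; ring
  obtain ⟨hcard, σ, hσ⟩ := regroupingRigid_of_cov ht hcov' (by rw [Fintype.card_fin]; exact hR) hu hα hf
  rw [Fintype.card_fin] at hcard
  exact ⟨hcard, σ, hσ⟩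

end

end Summit.PneNP.PneNP.Theorems.XorDoor.TriLine
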